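import Summits.Ventures.CertifiedManyBodySolver.Conjectures.RingSaturationPairing
import Summits.Ventures.CertifiedManyBodySolver.Conjectures.TwistedRingCertificate

/-!
# Ring saturation one site early (T-M1D.26), part 3/3: the general theorem, all `L ≥ 3`, `1 ≤ N ≤ L − 1`

HONEST FRAMING: first certified bounds; not a superconductivity verdict; every number certified
or labelled float.  (Venture `CertifiedManyBodySolver`, programme `hubbard-alg`, team M1 seat 4,
structure notes `STRUCTURE-TM1-doped.md` entry T-M1D.26; proof of record with the discovery path
`structure/ringsat/RING-SAT-THEOREM.md`; setting and notation of `OneBodySection.lean`.)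

**Theorem (`ringSaturation_hop_le`, `ringSaturation_attained`).**  For every ring length `L ≥ 3`
and shell number `1 ≤ N ≤ L − 1`: every one-body sequence `g` with `g 0 = N/L` whose `(L−1)`-site
Toeplitz section satisfies `0 ⪯ T_{L−1}(g) ⪯ 1` has `g 1 ≤ sin(Nπ/L)/(L·sin(π/L))`, and the bound
is attained by the parity-twisted free `L`-ring sequence `g_N` of `TwistedRingCertificate.lean`
(feasible on the `L` window, hence on the `L − 1` window by principal submatrices).  In the
language of the structure notes: the translation-invariant one-body window bound SATURATES at the
free-ring value one site before the window closes into the ring,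
`E¹_[L−1](2N/L) = E¹_[L](2N/L) = e_ring(L; N/L) = −(4/L)·sin(πN/L)/sin(π/L)`.
It contains, as instances, `ToeplitzWindowRing8` `(8,¼)`, `ToeplitzWindowSeven38` `(8,⅜)`,
`ToeplitzWindowEleven` `(12,¼)`, `ToeplitzWindowEleven512` `(12,5/12)` and the window-`(L−1)` case
of the flat family `RingSaturationFlat` `(L,1/L)`.

Proof: weak duality `hop_le_of_certificate` (`OneBodySection.lean`) with the PSD-by-inspection
certificate `(R, S)` of `RingSaturationPairing.lean` and its pairing identity gives
`4·g 1 ≤ tr S + (4cos(πN/L)/cos(π/L))·N/L`; `tr P_n = 2L` (`P_trace`), only the `N − 1` occupied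
bonds weigh in `tr S = 2L·λ·Σ_{n<N−1}(cos φ_n − cos(πN/L))` (`Smat_trace`, the sign lemmas of
part 1), and the occupied-bond sum telescopes (`sum_cos_phi`) to the ring value.  The discovery path
(Bézout reduction of the dual symbol fixing `K_c = cos(πN/L)/cos(π/L)`, then a least-squares fit
exposing the nearest-neighbour momentum-bond Laplacian at relative residual `1e-15`, then exact
verification in `ℚ(ζ_{2L})` for 72 instances) is recorded in `structure/ringsat/RING-SAT-THEOREM.md`.
-/

namespace Summit.Ventures.CertifiedManyBodySolver.Conjectures.RingSaturation

open Complex Finset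
open scoped Real

variable (L N : ℕ)

/-! ## Traces of the certificate -/

/-- The section of `δ₀` is the identity. -/
theorem toeplitzSection_delta (S : ℕ) :
    toeplitzSection S (fun j => if j = 0 then (1 : ℝ) else 0) = 1 := by
  ext x y
  simp only [toeplitzSection, Matrix.of_apply, Matrix.one_apply]
  by_cases h : x = y
  · subst h; simp
  · have hne : ((x : ℕ) - y) + ((y : ℕ) - x) ≠ 0 := by
      intro h'
      apply h
      ext
      omega
    rw [if_neg hne, if_neg h]

/-- `tr(S − R) = −4cos(πN/L)/cos(π/L)`. -/
theorem trace_Smat_sub_Rmat (hL : 3 ≤ L) :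
    (Smat L N - Rmat L N).trace = -(4 * Real.cos (π * N / L) / Real.cos (π / L)) := by
  have h := pairing L N hL (fun j => if j = 0 then (1 : ℝ) else 0)
  rw [toeplitzSection_delta, Matrix.mul_one] at h
  rw [h]; simp

/-- `tr P_n = Σ_x |a_{x+1}|² = 2L`. -/
theorem P_trace (hL : 3 ≤ L) (n : ℕ) : (P L N n).trace = 2 * L := by
  unfold P
  rw [Matrix.trace_add]
  simp only [Matrix.trace, Matrix.diag_apply, Matrix.vecMulVec_apply]
  rw [← Finset.sum_add_distrib]
  simp_rw [pq_eq_re, v_mul_conj]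
  have h0 : ∀ x : Fin (L - 1), (siteFac L ((x : ℕ) + 1) * (starRingEnd ℂ) (siteFac L ((x : ℕ) + 1))
      * cexp ((((x : ℕ) : ℤ) - ((x : ℕ) : ℤ) : ℤ) * θ L N n * I)).re
      = (siteFac L ((x : ℕ) + 1) * (starRingEnd ℂ) (siteFac L ((x : ℕ) + 1))).re := by
    intro x; simp
  simp_rw [h0]
  have hconv : (∑ x : Fin (L - 1), (siteFac L ((x : ℕ) + 1)
      * (starRingEnd ℂ) (siteFac L ((x : ℕ) + 1))).re)
      = ∑ x ∈ range (L - 1), (siteFac L (x + 1) * (starRingEnd ℂ) (siteFac L (x + 1))).re := by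
    simp only [Finset.sum_range]
  rw [hconv, ← Complex.re_sum, windowSum_zero L (by omega)]
  simp

/-- `tr S = 2L·λ·Σ_{n<N−1}(cos φ_n − cos(πN/L))`: only the occupied bonds carry weight. -/
theorem Smat_trace (hL : 3 ≤ L) (hN : 1 ≤ N) (hNL : N ≤ L) :
    (Smat L N).trace = 2 * L * ∑ n ∈ range (N - 1), (-(lam L * G L N n)) := by
  unfold Smat
  rw [Matrix.trace_sum]
  simp_rw [Matrix.trace_smul, P_trace L N hL, smul_eq_mul]
  rw [← Finset.sum_range_add_sum_Ico _ (show N - 1 ≤ L by omega)]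
  have hocc : ∀ n ∈ range (N - 1), max (-(lam L * G L N n)) 0 * (2 * L : ℝ)
      = 2 * L * (-(lam L * G L N n)) := by
    intro n hn
    simp only [mem_range] at hn
    have hG := G_nonpos L N hNL (n := n) (by omega)
    have : 0 ≤ -(lam L * G L N n) := by
      have := lam_pos L hL; nlinarith
    rw [max_eq_left this]; ring
  have hun : ∀ n ∈ Finset.Ico (N - 1) L, max (-(lam L * G L N n)) 0 * (2 * L : ℝ) = 0 := by
    intro n hn
    simp only [Finset.mem_Ico] at hn
    have hG := G_nonneg L N (n := n) (by omega) (by omega)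
    have : -(lam L * G L N n) ≤ 0 := by
      have := lam_pos L hL; nlinarith
    rw [max_eq_right this]; ring
  rw [Finset.sum_congr rfl hocc, Finset.sum_congr rfl hun, Finset.sum_const_zero, add_zero,
    Finset.mul_sum]

/-- Telescoping: `sin(π/L)·Σ_{n<M} cos((2 − N + 2n)π/L) = (sin((1−N+2M)π/L) − sin((1−N)π/L))/2`. -/
theorem sum_cos_phi (M : ℕ) :
    Real.sin (π / L) * ∑ n ∈ range M, Real.cos (θ L N n + π / L)
      = (Real.sin ((1 - N + 2 * M) * π / L) - Real.sin ((1 - (N : ℝ)) * π / L)) / 2 := by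
  have key : ∀ n : ℕ, Real.sin (π / L) * Real.cos (θ L N n + π / L)
      = (Real.sin (θ L N (n + 1)) - Real.sin (θ L N n)) / 2 := by
    intro n
    have e1 : θ L N (n + 1) = (θ L N n + π / L) + π / L := by simp only [θ]; push_cast; ring
    have e2 : Real.sin (θ L N n) = Real.sin ((θ L N n + π / L) - π / L) := by
      congr 1; ring
    rw [e1, e2, Real.sin_add, Real.sin_sub]
    ring
  rw [Finset.mul_sum]
  simp_rw [key]
  rw [← Finset.sum_div, Finset.sum_range_sub (fun n => Real.sin (θ L N n)) M]
  simp only [θ]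
  push_cast
  ring_nf

/-- **Ring saturation one site early (T-M1D.26).**  For every ring length `L ≥ 3` and shell
number `1 ≤ N ≤ L − 1`: a one-body sequence with `g 0 = N/L` whose `(L−1)`-site section satisfies
`0 ⪯ T_{L−1}(g) ⪯ 1` has `g 1 ≤ sin(πN/L)/(L·sin(π/L))`, i.e. the translation-invariant free
window bound on `L − 1` sites already equals the optimally twisted free `L`-ring value
`E¹_[L−1](2N/L) = −(4/L)·sin(πN/L)/sin(π/L)` (attainment is the ring state itself). -/
theorem ringSaturation_hop_le (hL : 3 ≤ L) (hN : 1 ≤ N) (hNL : N + 1 ≤ L) {g : ℕ → ℝ}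
    (hg : g 0 = N / L) (hT : (toeplitzSection (L - 1) g).PosSemidef)
    (hI : (1 - toeplitzSection (L - 1) g).PosSemidef) :
    g 1 ≤ Real.sin (N * π / L) / (L * Real.sin (π / L)) := by
  rw [show ((N : ℝ) * π / L) = π * N / L by ring]
  have hL' : (0 : ℝ) < L := by exact_mod_cast (show 0 < L by omega)
  have hc := cos_pi_div_pos L hL
  have hs : 0 < Real.sin (π / L) := by
    apply Real.sin_pos_of_pos_of_lt_pi (by positivity)
    rw [div_lt_iff₀ hL']
    have : (3 : ℝ) ≤ L := by exact_mod_cast hL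
    nlinarith [Real.pi_pos]
  -- the certificate inequality
  have hpair : ((Smat L N - Rmat L N) * toeplitzSection (L - 1) g).trace
      = g 0 * (Smat L N - Rmat L N).trace + 4 * g 1 := by
    rw [pairing L N hL, trace_Smat_sub_Rmat L N hL]; ring
  have h4 := hop_le_of_certificate (Rmat_posSemidef L N) (Smat_posSemidef L N) hT hI hpair
  rw [trace_Smat_sub_Rmat L N hL, Smat_trace L N hL hN (by omega), hg] at h4
  -- evaluate the occupied-bond sum by telescoping
  have htel := sum_cos_phi L N (N - 1)
  have hG : ∑ n ∈ range (N - 1), (-(lam L * G L N n))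
      = lam L * (∑ n ∈ range (N - 1), Real.cos (θ L N n + π / L)
          - (N - 1 : ℕ) * Real.cos (π * N / L)) := by
    simp only [G]
    rw [mul_sub, Finset.mul_sum]
    have : (lam L) * (((N - 1 : ℕ) : ℝ) * Real.cos (π * N / L))
        = ∑ n ∈ range (N - 1), lam L * Real.cos (π * N / L) := by
      rw [Finset.sum_const, card_range, nsmul_eq_mul]; ring
    rw [this, ← Finset.sum_sub_distrib]
    refine Finset.sum_congr rfl fun n _ => ?_
    ring
  rw [hG] at h4
  have hN1 : ((N - 1 : ℕ) : ℝ) = N - 1 := by rw [Nat.cast_sub hN]; simp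
  rw [hN1] at h4 htel
  -- htel: sin(π/L)·Σ = (sin((1-N+2(N-1))π/L) − sin((1−N)π/L))/2 = sin((N−1)π/L)
  have hsum : ∑ n ∈ range (N - 1), Real.cos (θ L N n + π / L)
      = Real.sin (((N : ℝ) - 1) * π / L) / Real.sin (π / L) := by
    rw [eq_div_iff hs.ne', mul_comm, htel]
    have e1 : (1 - (N : ℝ) + 2 * ((N : ℝ) - 1)) * π / L = ((N : ℝ) - 1) * π / L := by ring
    have e2 : (1 - (N : ℝ)) * π / L = -(((N : ℝ) - 1) * π / L) := by ring
    rw [e1, e2, Real.sin_neg]; ring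
  rw [hsum] at h4
  -- sin((N−1)π/L) = sin(πN/L)cos(π/L) − cos(πN/L)sin(π/L)
  have hsub : Real.sin (((N : ℝ) - 1) * π / L)
      = Real.sin (π * N / L) * Real.cos (π / L) - Real.cos (π * N / L) * Real.sin (π / L) := by
    rw [show ((N : ℝ) - 1) * π / L = π * N / L - π / L by ring, Real.sin_sub]
  rw [hsub] at h4
  -- now pure algebra
  unfold lam at h4
  have key : 2 * (L : ℝ) * (2 / ((L : ℝ) ^ 2 * Real.cos (π / L))
      * ((Real.sin (π * N / L) * Real.cos (π / L) - Real.cos (π * N / L) * Real.sin (π / L))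
          / Real.sin (π / L) - ((N : ℝ) - 1) * Real.cos (π * N / L)))
      - (N : ℝ) / L * -(4 * Real.cos (π * N / L) / Real.cos (π / L))
      = 4 * (Real.sin (π * N / L) / (L * Real.sin (π / L))) := by
    field_simp
    ring
  rw [key] at h4
  linarith


/-! ## Attainment: the twisted free `L`-ring restricted to the window -/

/-- A shorter window section is a principal submatrix of a longer one. -/
theorem toeplitzSection_castLE (S S' : ℕ) (h : S' ≤ S) (g : ℕ → ℝ) :
    toeplitzSection S' g = (toeplitzSection S g).submatrix (Fin.castLE h) (Fin.castLE h) := by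
  ext x y; simp [toeplitzSection]

/-- **Attainment.** The parity-twisted free `L`-ring sequence `g_N` of
`TwistedRingCertificate.lean` (feasible on the full `L` window, `twistedSection_feasible`) stays
feasible on the `L − 1` window (principal submatrices) and has `g_N 1 = sin(Nπ/L)/(L·sin(π/L))`;
with `ringSaturation_hop_le` this is `E¹_[L−1](2N/L) = −(4/L)·sin(πN/L)/sin(π/L) = e_ring(L; N/L)`
exactly. -/
theorem ringSaturation_attained (hL : 3 ≤ L) (hNL : N ≤ L) :
    ∃ g : ℕ → ℝ, g 0 = N / L ∧ g 1 = Real.sin (N * π / L) / (L * Real.sin (π / L)) ∧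
      (toeplitzSection (L - 1) g).PosSemidef ∧ (1 - toeplitzSection (L - 1) g).PosSemidef := by
  obtain ⟨hT, hI, h0, h1⟩ := twistedSection_feasible L N (by omega) hNL
  refine ⟨twistedSection L N, h0, h1, ?_, ?_⟩
  · rw [toeplitzSection_castLE L (L - 1) (by omega)]
    exact hT.submatrix _
  · have : (1 : Matrix (Fin (L - 1)) (Fin (L - 1)) ℝ) - toeplitzSection (L - 1) (twistedSection L N)
        = (1 - toeplitzSection L (twistedSection L N)).submatrix
            (Fin.castLE (by omega : L - 1 ≤ L)) (Fin.castLE (by omega : L - 1 ≤ L)) := by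
      ext x y
      simp [toeplitzSection, Matrix.one_apply, Fin.ext_iff]
    rw [this]; exact hI.submatrix _

end Summit.Ventures.CertifiedManyBodySolver.Conjectures.RingSaturation
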